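import Literature.Probability.LatticeModels.LebowitzPairTruncationIsing
import Literature.Probability.LatticeModels.GriffithsMonotonicity
import HarnessLib

/-!
# Stub `stub_holeCapacityPointwise` (line `box-superset`, crux `CoerciveSharpness.PhiCoercive`, stmt-CriticalPhenomena-18196)

The CAPACITY jaw of `SupersetStable` (idea card `hole-capacity-chain-rule`, Lebowitz form): free
b.c., zero field, `β ≥ 0`, `S ⊆ Λ`; deleting the holes `H = Λ ∖ S` lowers `⟨σ_aσ_x⟩` (`a, x ∈ S`) by
at most `β Σ_{h ∈ H} Σ_{y ∼ h, y ∈ Λ} (⟨σ_aσ_h⟩_Λ⟨σ_yσ_x⟩_Λ + ⟨σ_aσ_y⟩_Λ⟨σ_hσ_x⟩_Λ)`.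

Proof (Glimm–Jaffe 1987, Prop. 4.2.1, Cor. 4.3.3; Lebowitz 1974) in the `gksExpect` framework:
scale the couplings of the bonds of `Λ` with an endpoint in `H` by `t ∈ [0, 1]` (`cplAt`); `t = 1`
is the free measure on `Λ` (`isingTwoPoint_eq_gksExpect`), `t = 0` the decoupled system with
`S`-marginal the free measure on `S` (`isingCorr_free_eq_gksExpect_decoupled`); the derivative
(`hasDerivAt_gksExpect_cplAt_cov`) is bounded bond by bond by the SHARP pair-truncation bound
`gksExpect_two_mul_cov_le_sum_odd` and `gksExpect_mono_of_abs_le`, the mean value inequality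
integrates, and every bond at a hole is hit at least once by the `(h, y)` double sum (GKS I).
-/

noncomputable section

namespace Summit.CriticalPhenomena.Ising3DConformalLimit.Cruxes.PhiCoercive.BoxSuperset

open scoped BigOperators symmDiff
open Finset
open Literature.Probability.LatticeModels

/-! ## Finite bookkeeping -/

/-- For `f ≥ 0`, the sum over `insert a S` is at most `f a` plus the sum over `S`. -/
private theorem sum_insert_le_of_nonneg {α : Type*} [DecidableEq α] {f : α → ℝ} (hf : ∀ i, 0 ≤ f i)
    (a : α) (S : Finset α) : ∑ i ∈ insert a S, f i ≤ f a + ∑ i ∈ S, f i := by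
  by_cases ha : a ∈ S
  · rw [Finset.insert_eq_of_mem ha]
    linarith [hf a]
  · rw [Finset.sum_insert ha]

/-- `{a, x} ∖ {a} = {x}` for `a ≠ x`. -/
private theorem pair_sdiff_left {Λ : Type*} [DecidableEq Λ] {a x : Λ} (h : a ≠ x) :
    ({a, x} : Finset Λ) \ {a} = {x} := by
  ext w
  by_cases hw : w = a <;> simp [hw, h]

/-- `{a, x} ∖ {x} = {a}` for `a ≠ x`. -/
private theorem pair_sdiff_right {Λ : Type*} [DecidableEq Λ] {a x : Λ} (h : a ≠ x) :
    ({a, x} : Finset Λ) \ {x} = {a} := by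
  ext w
  by_cases hw : w = x <;> simp [hw, h.symm]

/-- The pairs `(A₁, B₁)` with `A₁ ⊆ {a, x}`, `B₁ ⊆ {p, q}` and `|A₁|, |B₁|` odd are among the four
pairs of singletons. -/
private theorem oddOddPairs_subset {Λ : Type*} [DecidableEq Λ] (a x p q : Λ) :
    ((({a, x} : Finset Λ).powerset ×ˢ ({p, q} : Finset Λ).powerset).filter
        (fun pr => Odd pr.1.card ∧ Odd pr.2.card)) ⊆
      {(({a} : Finset Λ), ({p} : Finset Λ)), ({a}, {q}), ({x}, {p}), ({x}, {q})} := by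
  intro pr hpr
  simp only [Finset.mem_filter, Finset.mem_product, Finset.mem_powerset] at hpr
  obtain ⟨⟨h1, h2⟩, ho1, ho2⟩ := hpr
  -- an odd subset of a pair is the singleton of one of its two elements
  have key : ∀ {u v : Λ} {X : Finset Λ}, X ⊆ {u, v} → Odd X.card → X = {u} ∨ X = {v} := by
    intro u v X hX hodd
    have hle : X.card ≤ 2 := (Finset.card_le_card hX).trans Finset.card_le_two
    have hc : X.card = 1 := by
      obtain ⟨k, hk⟩ := hodd
      omega
    obtain ⟨w, rfl⟩ := Finset.card_eq_one.1 hc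
    have hw : w ∈ ({u, v} : Finset Λ) := hX (Finset.mem_singleton_self w)
    simp only [Finset.mem_insert, Finset.mem_singleton] at hw
    exact hw.imp (fun h => by rw [h]) (fun h => by rw [h])
  have hpr : pr = (pr.1, pr.2) := rfl
  rw [hpr]
  rcases key h1 ho1 with e1 | e1 <;> rcases key h2 ho2 with e2 | e2 <;> rw [e1, e2] <;> simp

/-- For `F ≥ 0`, the sum of `F` over the odd–odd pairs of subsets of `({a, x}, {p, q})` is at most
the sum of its values at the four pairs of singletons. -/
private theorem sum_oddOddPairs_le {Λ : Type*} [DecidableEq Λ] (a x p q : Λ)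
    {F : Finset Λ × Finset Λ → ℝ} (hF : ∀ pr, 0 ≤ F pr) :
    ∑ pr ∈ ((({a, x} : Finset Λ).powerset ×ˢ ({p, q} : Finset Λ).powerset).filter
        (fun pr => Odd pr.1.card ∧ Odd pr.2.card)), F pr ≤
      F ({a}, {p}) + F ({a}, {q}) + F ({x}, {p}) + F ({x}, {q}) := by
  refine (Finset.sum_le_sum_of_subset_of_nonneg (oddOddPairs_subset a x p q)
    (fun pr _ _ => hF pr)).trans ?_
  refine (sum_insert_le_of_nonneg hF _ _).trans ?_
  rw [add_assoc, add_assoc]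
  refine add_le_add le_rfl ((sum_insert_le_of_nonneg hF _ _).trans ?_)
  refine add_le_add le_rfl ((sum_insert_le_of_nonneg hF _ _).trans ?_)
  rw [Finset.sum_singleton]

/-! ## The sharp Lebowitz bound for pair observables and the coupling path -/

section GKS

variable {Λ : Type*} [Fintype Λ] [DecidableEq Λ] {ι : Type*} [DecidableEq ι]
variable (s : Finset ι) (K : ι → ℝ) (C : ι → Finset Λ)

omit [DecidableEq ι] in
/-- **Sharp pair-truncation bound for pair observables** (Glimm–Jaffe 1987, Cor. 4.3.3, `A = {a, x}`,
`B = {p, q}`; Lebowitz 1974): `Kᵢ ≥ 0` on supports of `≤ 2` sites, nonzero terms of even support,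
`a ≠ x`, `p ≠ q`: `⟨σ_aσ_xσ_pσ_q⟩ - ⟨σ_aσ_x⟩⟨σ_pσ_q⟩ ≤ ⟨σ_aσ_p⟩⟨σ_xσ_q⟩ + ⟨σ_aσ_q⟩⟨σ_xσ_p⟩` (the four
odd–odd ordered partitions give each product twice). [cite: GlimmJaffe1987, Cor. 4.3.3] -/
private theorem gksExpect_cov_spinPair_le_sharp (hK : ∀ i ∈ s, 0 ≤ K i)
    (hC : ∀ i ∈ s, (C i).card ≤ 2) (heven : ∀ i ∈ s, K i = 0 ∨ Even (C i).card)
    {a x p q : Λ} (hax : a ≠ x) (hpq : p ≠ q) :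
    gksExpect s K C (fun σ => spinPair a x σ * spinPair p q σ) -
        gksExpect s K C (spinPair a x) * gksExpect s K C (spinPair p q) ≤
      gksExpect s K C (spinPair a p) * gksExpect s K C (spinPair x q) +
        gksExpect s K C (spinPair a q) * gksExpect s K C (spinPair x p) := by
  have h0 : ∀ X : Finset Λ, 0 ≤ gksExpect s K C (spinProduct X) :=
    fun X => gksExpect_spinProduct_nonneg s K C hK X
  have hOdd : ∀ X : Finset Λ, Odd X.card → gksExpect s K C (spinProduct X) = 0 := fun X hX => by
    rw [gksExpect, gksSum_spinProduct_eq_zero_of_odd s K C heven hX, zero_div]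
  have hA : Even ({a, x} : Finset Λ).card := by rw [Finset.card_pair hax]; exact even_two
  have hB : Even ({p, q} : Finset Λ).card := by rw [Finset.card_pair hpq]; exact even_two
  have hmain := gksExpect_two_mul_cov_le_sum_odd s K C hK hC hOdd hA hB
  have h4 := sum_oddOddPairs_le a x p q
    (F := fun pr : Finset Λ × Finset Λ => gksExpect s K C (spinProduct (pr.1 ∆ pr.2)) *
      gksExpect s K C (spinProduct ((({a, x} : Finset Λ) \ pr.1) ∆ (({p, q} : Finset Λ) \ pr.2))))
    (fun pr => mul_nonneg (h0 _) (h0 _))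
  simp only [pair_sdiff_left hax, pair_sdiff_right hax, pair_sdiff_left hpq,
    pair_sdiff_right hpq] at h4
  have h := hmain.trans h4
  -- rewrite the pair observables as spin products
  have hprod : (fun σ => spinPair a x σ * spinPair p q σ) =
      spinProduct (({a, x} : Finset Λ) ∆ {p, q}) := by
    funext σ
    rw [← spinProduct_pair_eq_spinPair hax, ← spinProduct_pair_eq_spinPair hpq,
      spinProduct_mul_eq_spinProduct_symmDiff]
  rw [hprod, ← spinProduct_pair_eq_spinPair hax, ← spinProduct_pair_eq_spinPair hpq]
  simp only [spinPair_eq_spinProduct_singleton_symmDiff]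
  linarith [h, mul_comm (gksExpect s K C (spinProduct ({x} ∆ {p})))
      (gksExpect s K C (spinProduct ({a} ∆ {q}))),
    mul_comm (gksExpect s K C (spinProduct ({x} ∆ {q})))
      (gksExpect s K C (spinProduct ({a} ∆ {p})))]

omit [DecidableEq ι] in
/-- The expectation `⟨f⟩_{Λ;K}` depends on the couplings only through their values on `s`. -/
private theorem gksExpect_congr_couplings {K K' : ι → ℝ} (h : ∀ i ∈ s, K i = K' i)
    (f : SpinConfig Λ → ℝ) : gksExpect s K C f = gksExpect s K' C f := by
  have hw : ∀ ω, gksWeight s K C ω = gksWeight s K' C ω := fun ω => by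
    simp only [gksWeight, gksHamiltonian]
    rw [Finset.sum_congr rfl fun i hi => by rw [h i hi]]
  simp only [gksExpect, gksSum, hw]

variable (B : Finset ι) (px py : ι → Λ)

/-- **Switching on a set `B` of bonds `{xᵢ, yᵢ}` from a nonzero start** (Glimm–Jaffe 1987,
Prop. 4.2.1 with Cor. 4.3.3; zero field, `Kᵢ ≥ 0` on supports of `≤ 2` sites, `a ≠ z`):
`⟨σ_aσ_z⟩_K - ⟨σ_aσ_z⟩_{cplOff} ≤ Σ_{i ∈ B} Kᵢ (⟨σ_aσ_{xᵢ}⟩_K⟨σ_{yᵢ}σ_z⟩_K + ⟨σ_aσ_{yᵢ}⟩_K⟨σ_{xᵢ}σ_z⟩_K)`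
(derivative along `cplAt K B t`, sharp Lebowitz bound, `⟨·⟩_t ≤ ⟨·⟩_K`, mean value inequality).
[cite: GlimmJaffe1987, Prop. 4.2.1 and Cor. 4.3.3] -/
private theorem gksExpect_spinPair_sub_cplOff_le (hK : ∀ i ∈ s, 0 ≤ K i)
    (hC : ∀ i ∈ s, (C i).card ≤ 2) (heven : ∀ i ∈ s, K i = 0 ∨ Even (C i).card)
    (hBs : B ⊆ s) (hB : ∀ i ∈ B, C i = {px i, py i}) (hpxy : ∀ i ∈ B, px i ≠ py i)
    {a z : Λ} (haz : a ≠ z) :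
    gksExpect s K C (spinPair a z) - gksExpect s (cplOff K B) C (spinPair a z) ≤
      ∑ i ∈ B, K i * (gksExpect s K C (spinPair a (px i)) * gksExpect s K C (spinPair (py i) z) +
        gksExpect s K C (spinPair a (py i)) * gksExpect s K C (spinPair (px i) z)) := by
  set M := ∑ i ∈ B, K i * (gksExpect s K C (spinPair a (px i)) * gksExpect s K C (spinPair (py i) z) +
    gksExpect s K C (spinPair a (py i)) * gksExpect s K C (spinPair (px i) z)) with hM
  set Φ : ℝ → ℝ := fun t => gksExpect s (cplAt K B t) C (spinPair a z) with hΦ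
  have hder : ∀ t, HasDerivAt Φ (∑ i ∈ B, K i *
      (gksExpect s (cplAt K B t) C (fun ω => spinPair a z ω * spinPair (px i) (py i) ω) -
        gksExpect s (cplAt K B t) C (spinPair a z) *
          gksExpect s (cplAt K B t) C (spinPair (px i) (py i)))) t :=
    fun t => hasDerivAt_gksExpect_cplAt_cov s K C B px py hBs hB hpxy (spinPair a z) t
  -- the derivative is bounded by `M` on `[0, 1]`
  have hbound : ∀ t, 0 ≤ t → t ≤ 1 → ∑ i ∈ B, K i *
      (gksExpect s (cplAt K B t) C (fun ω => spinPair a z ω * spinPair (px i) (py i) ω) -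
        gksExpect s (cplAt K B t) C (spinPair a z) *
          gksExpect s (cplAt K B t) C (spinPair (px i) (py i))) ≤ M := by
    intro t ht0 ht1
    have hKt := cplAt_nonneg s K B hK ht0
    have habs := abs_cplAt_le s K B hK ht0 ht1
    have hevent : ∀ i ∈ s, cplAt K B t i = 0 ∨ Even (C i).card := fun i hi =>
      (heven i hi).imp (fun h0 => by simp [cplAt, h0]) id
    have hmono : ∀ u v : Λ,
        gksExpect s (cplAt K B t) C (spinPair u v) ≤ gksExpect s K C (spinPair u v) := fun u v => by
      rw [spinPair_eq_spinProduct_singleton_symmDiff]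
      exact gksExpect_mono_of_abs_le s C habs _
    have hnn : ∀ u v : Λ, 0 ≤ gksExpect s (cplAt K B t) C (spinPair u v) := fun u v => by
      rw [spinPair_eq_spinProduct_singleton_symmDiff]
      exact gksExpect_spinProduct_nonneg s _ C hKt _
    have hnnK : ∀ u v : Λ, 0 ≤ gksExpect s K C (spinPair u v) := fun u v => by
      rw [spinPair_eq_spinProduct_singleton_symmDiff]
      exact gksExpect_spinProduct_nonneg s _ C hK _
    refine Finset.sum_le_sum fun i hi => mul_le_mul_of_nonneg_left ?_ (hK i (hBs hi))
    refine (gksExpect_cov_spinPair_le_sharp s (cplAt K B t) C hKt hC hevent haz (hpxy i hi)).trans ?_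
    rw [spinPair_comm z (py i), spinPair_comm z (px i)]
    exact add_le_add (mul_le_mul (hmono _ _) (hmono _ _) (hnn _ _) (hnnK _ _))
      (mul_le_mul (hmono _ _) (hmono _ _) (hnn _ _) (hnnK _ _))
  have hdiff : Differentiable ℝ Φ := fun t => (hder t).differentiableAt
  have hderiv_le : ∀ t ∈ interior (Set.Icc (0 : ℝ) 1), deriv Φ t ≤ M := by
    intro t ht
    rw [interior_Icc] at ht
    rw [(hder t).deriv]
    exact hbound t ht.1.le ht.2.le
  have hmvt := (convex_Icc (0 : ℝ) 1).image_sub_le_mul_sub_of_deriv_le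
    hdiff.continuous.continuousOn hdiff.differentiableOn hderiv_le 0
    (Set.left_mem_Icc.2 zero_le_one) 1 (Set.right_mem_Icc.2 zero_le_one) zero_le_one
  have h1 : Φ 1 = gksExpect s K C (spinPair a z) := by simp only [hΦ, cplAt_one]
  have h0 : Φ 0 = gksExpect s (cplOff K B) C (spinPair a z) := by simp only [hΦ, cplAt_zero]
  rw [h1, h0, sub_zero, mul_one] at hmvt
  exact hmvt

end GKS

/-! ## The Ising form on a locally finite graph -/

/-- **Deleting holes lowers pair correlations by at most `β ·` (two-point products over the bonds at
the holes)**: free b.c., zero field, `β ≥ 0`, any locally finite graph, `S ⊆ Λ`, `a, x ∈ S`: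
`⟨σ_aσ_x⟩_Λ - ⟨σ_aσ_x⟩_S ≤ β Σ_{h ∈ Λ∖S} Σ_{y ∼ h, y ∈ Λ} (⟨σ_aσ_h⟩_Λ⟨σ_yσ_x⟩_Λ + ⟨σ_aσ_y⟩_Λ⟨σ_hσ_x⟩_Λ)`.
[cite: GlimmJaffe1987, Prop. 4.2.1 and Cor. 4.3.3] -/
private theorem isingTwoPoint_sub_le_hole_sum {V : Type*} [DecidableEq V] (G : SimpleGraph V)
    [G.LocallyFinite] {β : ℝ} (hβ : 0 ≤ β) {S Λ : Finset V} (hSΛ : S ⊆ Λ) {a x : V}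
    (ha : a ∈ S) (hx : x ∈ S) :
    isingTwoPoint G Λ β 0 .free a x - isingTwoPoint G S β 0 .free a x ≤
      β * ∑ h ∈ Λ \ S, ∑ y ∈ (G.neighborFinset h).filter (fun y => y ∈ Λ),
        (isingTwoPoint G Λ β 0 .free a h * isingTwoPoint G Λ β 0 .free y x +
          isingTwoPoint G Λ β 0 .free a y * isingTwoPoint G Λ β 0 .free h x) := by
  classical
  obtain ⟨haΛ, hxΛ⟩ : a ∈ Λ ∧ x ∈ Λ := ⟨hSΛ ha, hSΛ hx⟩
  -- two-point functions inside `Λ` are nonnegative (GKS I)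
  have hU0 : ∀ {u v : V}, u ∈ Λ → v ∈ Λ → 0 ≤ isingTwoPoint G Λ β 0 .free u v := by
    intro u v hu hv
    rw [isingTwoPoint_eq_gksExpect G Λ β 0 .free hu hv, spinPair_eq_spinProduct_singleton_symmDiff]
    exact gksExpect_spinProduct_nonneg _ _ _ (gksCoupling_nonneg G hβ le_rfl (Or.inl rfl)) _
  -- the diagonal case is trivial
  rcases eq_or_ne a x with rfl | hax
  · simp only [isingTwoPoint_self, sub_self]
    refine mul_nonneg hβ (Finset.sum_nonneg fun h hh => Finset.sum_nonneg fun y hy => ?_)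
    have hhΛ : h ∈ Λ := (Finset.mem_sdiff.1 hh).1
    have hyΛ : y ∈ Λ := (Finset.mem_filter.1 hy).2
    exact add_nonneg (mul_nonneg (hU0 haΛ hhΛ) (hU0 hyΛ haΛ))
      (mul_nonneg (hU0 haΛ hyΛ) (hU0 hhΛ haΛ))
  -- the gks data
  set s := isingIdx G Λ with hs
  set K := gksCoupling G Λ β 0 .free with hKdef
  set C := isingSupp Λ with hCdef
  set T : Finset (Σ _ : V, V) := (Λ \ S).sigma fun h => (G.neighborFinset h).filter (fun y => y ∈ Λ)
    with hT
  set emb : (Σ _ : V, V) → Sym2 V ⊕ V := fun p => Sum.inl s(p.1, p.2) with hemb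
  set B := T.image emb with hB
  have hTmem : ∀ p ∈ T, p.1 ∈ Λ ∧ p.1 ∉ S ∧ p.2 ∈ Λ ∧ G.Adj p.1 p.2 := fun p hp => by
    rw [hT, Finset.mem_sigma, Finset.mem_sdiff, Finset.mem_filter, SimpleGraph.mem_neighborFinset] at hp
    exact ⟨hp.1.1, hp.1.2, hp.2.2, hp.2.1⟩
  -- every bond of `Λ` with an endpoint outside `S` is in `B`
  have hcover : ∀ {u v : V}, G.Adj u v → u ∈ Λ → v ∈ Λ → u ∉ S → (Sum.inl s(u, v) : Sym2 V ⊕ V) ∈ B :=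
    fun {u v} hadj hu hv huS => Finset.mem_image.2 ⟨⟨u, v⟩, Finset.mem_sigma.2
      ⟨Finset.mem_sdiff.2 ⟨hu, huS⟩, Finset.mem_filter.2
        ⟨(SimpleGraph.mem_neighborFinset G u v).2 hadj, hv⟩⟩, rfl⟩
  -- endpoints of the bonds of `B`
  have hex : ∀ i, i ∈ B → ∃ p, p ∈ T ∧ emb p = i := fun i hi => by
    simpa only [hB, Finset.mem_image] using hi
  haveI : Nonempty (Σ _ : V, V) := ⟨⟨a, a⟩⟩
  choose! pf hpfT hpf using hex
  set px : Sym2 V ⊕ V → ↥Λ := fun i => if h : (pf i).1 ∈ Λ then ⟨(pf i).1, h⟩ else ⟨a, haΛ⟩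
    with hpx
  set py : Sym2 V ⊕ V → ↥Λ := fun i => if h : (pf i).2 ∈ Λ then ⟨(pf i).2, h⟩ else ⟨a, haΛ⟩
    with hpy
  have hpfT' : ∀ i ∈ B, (pf i).1 ∈ Λ ∧ (pf i).1 ∉ S ∧ (pf i).2 ∈ Λ ∧ G.Adj (pf i).1 (pf i).2 :=
    fun i hi => hTmem _ (hpfT i hi)
  have hpx_val : ∀ i ∈ B, ((px i : ↥Λ) : V) = (pf i).1 := by
    intro i hi; simp only [hpx, dif_pos (hpfT' i hi).1]
  have hpy_val : ∀ i ∈ B, ((py i : ↥Λ) : V) = (pf i).2 := by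
    intro i hi; simp only [hpy, dif_pos (hpfT' i hi).2.2.1]
  -- the bonds of `T` are edges inside `Λ`, not inside `S`
  have hTedge : ∀ p ∈ T, s(p.1, p.2) ∈ edgesIn G Λ := fun p hp =>
    mem_edgesIn_iff.2 ⟨(SimpleGraph.mem_edgeSet G).2 (hTmem p hp).2.2.2, fun w hw => by
      rcases Sym2.mem_iff.1 hw with rfl | rfl
      exacts [(hTmem p hp).1, (hTmem p hp).2.2.1]⟩
  have hTnot : ∀ p ∈ T, s(p.1, p.2) ∉ edgesIn G S := by
    intro p hp hmem
    obtain ⟨-, h1S, -, -⟩ := hTmem p hp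
    exact h1S ((mem_edgesIn_iff.1 hmem).2 _ (Sym2.mem_mk_left _ _))
  have hBs : B ⊆ s := by
    intro i hi
    obtain ⟨p, hp, rfl⟩ := Finset.mem_image.1 hi
    simp only [hs, isingIdx, hemb, Finset.inl_mem_disjSum]
    exact edgesIn_subset_edgesTouching Λ (hTedge p hp)
  -- hypotheses of the gks theorem
  have hK : ∀ i ∈ s, 0 ≤ K i := gksCoupling_nonneg G hβ le_rfl (Or.inl rfl)
  have hC : ∀ i ∈ s, (C i).card ≤ 2 := fun i _ => card_isingSupp_le_two Λ i
  have heven : ∀ i ∈ s, K i = 0 ∨ Even (C i).card := gksCoupling_free_zero_eq_zero_or_even G Λ β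
  have hBC : ∀ i ∈ B, C i = {px i, py i} := by
    intro i hi
    have hi' : i = Sum.inl s((pf i).1, (pf i).2) := (hpf i hi).symm
    ext w
    rw [Finset.mem_insert, Finset.mem_singleton, Subtype.ext_iff, Subtype.ext_iff, hpx_val i hi,
      hpy_val i hi]
    conv_lhs => rw [hi']
    simp only [hCdef, isingSupp, Finset.mem_filter, Finset.mem_univ, true_and, Sym2.mem_iff]
  have hpxy : ∀ i ∈ B, px i ≠ py i := fun i hi h =>
    G.ne_of_adj (hpfT' i hi).2.2.2 (by rw [← hpx_val i hi, ← hpy_val i hi, h])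
  have hax' : (⟨a, haΛ⟩ : ↥Λ) ≠ ⟨x, hxΛ⟩ := fun h => hax (congrArg Subtype.val h)
  -- apply the gks theorem
  have hmain := gksExpect_spinPair_sub_cplOff_le s K C B px py hK hC heven hBs hBC hpxy hax'
  rw [← isingTwoPoint_eq_gksExpect G Λ β 0 .free haΛ hxΛ] at hmain
  -- the value at `t = 0` is the free pair correlation of `S`: the couplings are the decoupled ones
  have hcpl : ∀ i ∈ s, cplOff K B i = decoupledCoupling G S β 0 i := by
    rintro (e | v) hi
    · by_cases hiB : (Sum.inl e : Sym2 V ⊕ V) ∈ B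
      · have hnot : e ∉ edgesIn G S := by
          rw [Sum.inl_injective (hpf _ hiB).symm]; exact hTnot _ (hpfT _ hiB)
        simp [cplOff, hiB, decoupledCoupling, hnot]
      · simp only [cplOff, hiB, if_false, decoupledCoupling]
        by_cases he : e ∈ edgesIn G Λ
        · have heS : e ∈ edgesIn G S := by
            have he' := mem_edgesIn_iff.1 he
            rw [mem_edgesIn_iff]
            refine ⟨he'.1, ?_⟩
            induction e using Sym2.ind with
            | _ u v =>
              have huv : G.Adj u v := (SimpleGraph.mem_edgeSet G).1 he'.1
              have hu : u ∈ Λ := he'.2 u (Sym2.mem_mk_left u v)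
              have hv : v ∈ Λ := he'.2 v (Sym2.mem_mk_right u v)
              have huS : u ∈ S := by by_contra huS; exact hiB (hcover huv hu hv huS)
              have hvS : v ∈ S := by
                by_contra hvS; rw [Sym2.eq_swap] at hiB; exact hiB (hcover huv.symm hv hu hvS)
              intro w hw
              rcases Sym2.mem_iff.1 hw with rfl | rfl
              · exact huS
              · exact hvS
          rw [if_pos heS, hKdef, gksCoupling_inl_of_mem_edgesIn G β 0 (Or.inl rfl) he]
        · have heS : e ∉ edgesIn G S := fun h => he (edgesIn_mono G hSΛ h)
          simp [hKdef, gksCoupling, interactionEdges_free, he, heS]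
    · have hvB : (Sum.inr v : Sym2 V ⊕ V) ∉ B := by
        intro h
        obtain ⟨p, -, hp⟩ := Finset.mem_image.1 h
        exact Sum.inl_ne_inr hp
      simp [cplOff, hvB, hKdef, gksCoupling, decoupledCoupling]
  have h0 : gksExpect s (cplOff K B) C (spinPair ⟨a, haΛ⟩ ⟨x, hxΛ⟩) =
      isingTwoPoint G S β 0 .free a x := by
    have hAS : ({a, x} : Finset V) ⊆ S :=
      Finset.insert_subset_iff.2 ⟨ha, Finset.singleton_subset_iff.2 hx⟩
    rw [isingTwoPoint_eq_isingCorr G S β 0 .free hax,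
      isingCorr_free_eq_gksExpect_decoupled G hSΛ β 0 hAS]
    have hin : inVol Λ ({a, x} : Finset V) = {(⟨a, haΛ⟩ : ↥Λ), ⟨x, hxΛ⟩} := by
      ext w
      simp [mem_inVol, Subtype.ext_iff]
    rw [hin, spinProduct_pair_eq_spinPair hax']
    exact gksExpect_congr_couplings s C hcpl _
  rw [h0] at hmain
  refine hmain.trans ?_
  -- the sum over `B` in Ising vocabulary
  set U := fun u v : V => isingTwoPoint G Λ β 0 .free u v with hU
  set g : Sym2 V ⊕ V → ℝ := fun i =>
    β * (U a (pf i).1 * U (pf i).2 x + U a (pf i).2 * U (pf i).1 x) with hg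
  have hterm : ∀ i ∈ B, K i * (gksExpect s K C (spinPair ⟨a, haΛ⟩ (px i)) *
      gksExpect s K C (spinPair (py i) ⟨x, hxΛ⟩) +
      gksExpect s K C (spinPair ⟨a, haΛ⟩ (py i)) * gksExpect s K C (spinPair (px i) ⟨x, hxΛ⟩)) =
      g i := by
    intro i hi
    obtain ⟨h1Λ, -, h2Λ, -⟩ := hpfT' i hi
    have hpx1 : px i = ⟨(pf i).1, h1Λ⟩ := Subtype.ext (hpx_val i hi)
    have hpy1 : py i = ⟨(pf i).2, h2Λ⟩ := Subtype.ext (hpy_val i hi)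
    have hKi : K i = β := by
      rw [← hpf i hi]
      exact gksCoupling_inl_of_mem_edgesIn G β 0 (Or.inl rfl) (hTedge _ (hpfT i hi))
    rw [hpx1, hpy1, ← isingTwoPoint_eq_gksExpect G Λ β 0 .free haΛ h1Λ,
      ← isingTwoPoint_eq_gksExpect G Λ β 0 .free h2Λ hxΛ,
      ← isingTwoPoint_eq_gksExpect G Λ β 0 .free haΛ h2Λ,
      ← isingTwoPoint_eq_gksExpect G Λ β 0 .free h1Λ hxΛ, hKi]
  have hg0 : ∀ i ∈ B, 0 ≤ g i := fun i hi =>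
    mul_nonneg hβ (add_nonneg (mul_nonneg (hU0 haΛ (hpfT' i hi).1) (hU0 (hpfT' i hi).2.2.1 hxΛ))
      (mul_nonneg (hU0 haΛ (hpfT' i hi).2.2.1) (hU0 (hpfT' i hi).1 hxΛ)))
  rw [Finset.sum_congr rfl hterm]
  refine (Finset.sum_image_le_of_nonneg hg0).trans ?_
  -- each bond `{h, y}` with `h` a hole is hit by `(h, y)` (and by `(y, h)` if `y` is a hole too)
  have hswap : ∀ p ∈ T, g (emb p) = β * (U a p.1 * U p.2 x + U a p.2 * U p.1 x) := by
    intro p hp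
    have hi : emb p ∈ B := Finset.mem_image_of_mem emb hp
    have h' : s((pf (emb p)).1, (pf (emb p)).2) = s(p.1, p.2) := Sum.inl_injective (hpf _ hi)
    simp only [hg]
    rcases Sym2.eq_iff.1 h' with ⟨h1, h2⟩ | ⟨h1, h2⟩
    · rw [h1, h2]
    · rw [h1, h2]
      ring
  rw [Finset.sum_congr rfl hswap, ← Finset.mul_sum, Finset.sum_sigma]

/-! ## The stub -/

/-- **Stub `stub_holeCapacityPointwise` (hole capacity, pointwise Lebowitz form).** Ferromagnetic
n.n. Ising model on `ℤ³`, free b.c., zero field, `β ≥ 0`, `S ⊆ Λ` finite, `a, x ∈ S`: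
`⟨σ_aσ_x⟩^free_Λ - ⟨σ_aσ_x⟩^free_S ≤ β Σ_{h ∈ Λ∖S} Σ_{y ∼ h, y ∈ Λ} (⟨σ_aσ_h⟩_Λ⟨σ_yσ_x⟩_Λ + ⟨σ_aσ_y⟩_Λ⟨σ_hσ_x⟩_Λ)`
(coupling interpolation of the bonds at the holes, Glimm–Jaffe 1987 Prop. 4.2.1; sharp pair-truncation
bound Cor. 4.3.3 / Lebowitz 1974; GKS II monotonicity; over-counting of the bonds inside `Λ ∖ S`,
all terms `≥ 0` by GKS I). [cite: GlimmJaffe1987, Cor. 4.3.3] [cite: Lebowitz1974, Theorem] -/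
theorem stub_holeCapacityPointwise : ∀ (β : ℝ), 0 ≤ β → ∀ (S Λ : Finset (Site 3)), S ⊆ Λ →
    ∀ (a x : Site 3), a ∈ S → x ∈ S →
    isingTwoPoint (zdGraph 3) Λ β 0 .free a x - isingTwoPoint (zdGraph 3) S β 0 .free a x ≤
      β * ∑ h ∈ Λ \ S, ∑ y ∈ ((zdGraph 3).neighborFinset h).filter (fun y => y ∈ Λ),
        (isingTwoPoint (zdGraph 3) Λ β 0 .free a h * isingTwoPoint (zdGraph 3) Λ β 0 .free y x +
          isingTwoPoint (zdGraph 3) Λ β 0 .free a y * isingTwoPoint (zdGraph 3) Λ β 0 .free h x) :=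
  fun _ hβ _ _ hSΛ _ _ ha hx => isingTwoPoint_sub_le_hole_sum (zdGraph 3) hβ hSΛ ha hx

end Summit.CriticalPhenomena.Ising3DConformalLimit.Cruxes.PhiCoercive.BoxSuperset

end
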